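import Mathlib

/-!
# Mean coupling (normal form) for the coset sums of the crux `CosetDecorrelation`

Stub `stub_normalForm` of line `SketchIdeator3` of crux stmt-Parity-13317
(`Summit.Parity.GeneralizedHardyLittlewood.Theses.LiouvilleMAD.CosetDecorrelation`,
card `farey-level-mean-coupling`); Mathlib only.

For general real weights `f, g` on the dyadic block `(M, 2M]` and a modulus `j ≥ 1`, write
`A_f(a) = Σ_{m ∈ (M,2M], m ≡ a (mod j)} f(m)` for the class sums and
`T_j = Σ_{(m,m') ∈ (M,2M]², m ≡ m' (mod j)} f(m) g(m')` for the coset sum.  We prove: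

* `normalForm_coset_eq_classInner` : `T_j = Σ_{a<j} A_f(a) A_g(a)` (fibre the pair filter by
  `p.1 % j`; for `a < j` the filters `m ≡ a [MOD j]` and `m % j = a` coincide);
* `normalForm_sum_classSum` : `Σ_{a<j} A_f(a) = Σ_{m ∈ (M,2M]} f(m)` (the classes partition the
  block);
* `stub_normalForm` (MEAN COUPLING) :
  `T_j − (Σ f)(Σ g)/j = Σ_{a<j} (A_f(a) − (Σ f)/j) (A_g(a) − (Σ g)/j)`,
  obtained from the two identities above by expanding the product and using `card (range j) = j`.

This is the identity behind the mean-corrected coset decorrelation stub (K1) of the skeleton: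
the level-one (mean × mean) part of `T_j` is `(Σ f)(Σ g)/j`, and what is left is the inner product
on `ℤ/j` of the two mean-free class profiles.
-/

namespace Summit.Parity.GeneralizedHardyLittlewood.Theorems.CosetDecorrelation.FareyLevelMeanCoupling

open Finset

/-- For `a < j` the class filter `m ≡ a [MOD j]` is the fibre `m % j = a` of `m ↦ m % j`.
[folklore] -/
theorem normalForm_filter_modEq_eq (S : Finset ℕ) {j a : ℕ} (ha : a < j) :
    S.filter (fun m => m ≡ a [MOD j]) = S.filter (fun m => m % j = a) := by
  have ha' : a % j = a := Nat.mod_eq_of_lt ha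
  ext m
  simp only [mem_filter, Nat.ModEq, ha']

/-- For `a < j`, the product of the two `a`-classes of `(M,2M]` is the fibre over `a` (under
`p ↦ p.1 % j`) of the coset `{(m,m') ∈ (M,2M]² : m ≡ m' (mod j)}`. [folklore] -/
theorem normalForm_classProd_eq_fibre (M j a : ℕ) (ha : a < j) :
    ((Finset.Ioc M (2 * M)).filter (fun m => m ≡ a [MOD j])) ×ˢ
        ((Finset.Ioc M (2 * M)).filter (fun m => m ≡ a [MOD j]))
      = (((Finset.Ioc M (2 * M) ×ˢ Finset.Ioc M (2 * M)).filter
            (fun p : ℕ × ℕ => p.1 ≡ p.2 [MOD j])).filter (fun p : ℕ × ℕ => p.1 % j = a)) := by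
  have ha' : a % j = a := Nat.mod_eq_of_lt ha
  ext ⟨m, m'⟩
  simp only [mem_product, mem_filter, Nat.ModEq]
  constructor
  · rintro ⟨⟨hm, hma⟩, ⟨hm', hm'a⟩⟩
    refine ⟨⟨⟨hm, hm'⟩, ?_⟩, ?_⟩
    · rw [hma, hm'a]
    · rw [hma, ha']
  · rintro ⟨⟨⟨hm, hm'⟩, hmm'⟩, hma⟩
    refine ⟨⟨hm, ?_⟩, ⟨hm', ?_⟩⟩
    · rw [hma, ha']
    · rw [← hmm', hma, ha']

/-- **Class inner product.**  The coset sum is the inner product over `ℤ/j` of the two class-sum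
profiles: `Σ_{(m,m') ∈ (M,2M]², m ≡ m' (mod j)} f(m) g(m') = Σ_{a<j} A_f(a) A_g(a)` with
`A_f(a) = Σ_{m ∈ (M,2M], m ≡ a (mod j)} f(m)` (fibre the pair set by the common class `p.1 % j`).
[folklore] -/
theorem normalForm_coset_eq_classInner (f g : ℕ → ℝ) (M j : ℕ) (hj : 1 ≤ j) :
    (∑ p ∈ (Finset.Ioc M (2 * M) ×ˢ Finset.Ioc M (2 * M)).filter
        (fun p : ℕ × ℕ => p.1 ≡ p.2 [MOD j]), f p.1 * g p.2)
      = ∑ a ∈ Finset.range j,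
          (∑ m ∈ (Finset.Ioc M (2 * M)).filter (fun m => m ≡ a [MOD j]), f m) *
            (∑ m ∈ (Finset.Ioc M (2 * M)).filter (fun m => m ≡ a [MOD j]), g m) := by
  symm
  calc ∑ a ∈ range j, (∑ m ∈ (Ioc M (2 * M)).filter (fun m => m ≡ a [MOD j]), f m) *
          (∑ m ∈ (Ioc M (2 * M)).filter (fun m => m ≡ a [MOD j]), g m)
      = ∑ a ∈ range j, ∑ p ∈ ((Ioc M (2 * M)).filter (fun m => m ≡ a [MOD j])) ×ˢ
            ((Ioc M (2 * M)).filter (fun m => m ≡ a [MOD j])), f p.1 * g p.2 := by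
          refine sum_congr rfl fun a _ => ?_
          rw [sum_mul_sum, ← sum_product']
    _ = ∑ a ∈ range j, ∑ p ∈ (((Ioc M (2 * M) ×ˢ Ioc M (2 * M)).filter
            (fun p : ℕ × ℕ => p.1 ≡ p.2 [MOD j])).filter (fun p : ℕ × ℕ => p.1 % j = a)),
            f p.1 * g p.2 := by
          refine sum_congr rfl fun a ha => ?_
          rw [normalForm_classProd_eq_fibre M j a (mem_range.mp ha)]
    _ = _ := sum_fiberwise_of_maps_to (fun p _ => mem_range.mpr (Nat.mod_lt _ hj)) _

/-- **The classes partition the block.**  `Σ_{a<j} Σ_{m ∈ (M,2M], m ≡ a (mod j)} f(m) = Σ_{m ∈ (M,2M]} f(m)`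
for `j ≥ 1` (every `m` lies in exactly one class `a = m % j < j`). [folklore] -/
theorem normalForm_sum_classSum (f : ℕ → ℝ) (M j : ℕ) (hj : 1 ≤ j) :
    ∑ a ∈ Finset.range j, ∑ m ∈ (Finset.Ioc M (2 * M)).filter (fun m => m ≡ a [MOD j]), f m
      = ∑ m ∈ Finset.Ioc M (2 * M), f m := by
  rw [sum_congr rfl fun a ha => by rw [normalForm_filter_modEq_eq _ (mem_range.mp ha)]]
  exact sum_fiberwise_of_maps_to (fun m _ => mem_range.mpr (Nat.mod_lt _ hj)) _

/-- **MEAN COUPLING** (stub `stub_normalForm`, general real weights `f, g` on `(M,2M]`, `j ≥ 1`):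
the coset sum minus its level-one part `(Σ f)(Σ g)/j` is the inner product on `ℤ/j` of the two
mean-free class profiles,
`T_j − (Σ f)(Σ g)/j = Σ_{a<j} (A_f(a) − (Σ f)/j)(A_g(a) − (Σ g)/j)`.
Proof: `T_j = Σ_a A_f(a) A_g(a)` (`normalForm_coset_eq_classInner`), expand the right-hand product,
`Σ_a A_f(a) = Σ f`, `Σ_a A_g(a) = Σ g` (`normalForm_sum_classSum`), `card (range j) = j`, and clear
the denominator `j ≠ 0`. [folklore] -/
theorem stub_normalForm :
    ∀ (f g : ℕ → ℝ) (M j : ℕ), 1 ≤ j →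
      (∑ p ∈ (Finset.Ioc M (2 * M) ×ˢ Finset.Ioc M (2 * M)).filter
            (fun p : ℕ × ℕ => p.1 ≡ p.2 [MOD j]), f p.1 * g p.2)
        - (∑ m ∈ Finset.Ioc M (2 * M), f m) * (∑ m ∈ Finset.Ioc M (2 * M), g m) / (j : ℝ)
      = ∑ a ∈ Finset.range j,
          ((∑ m ∈ (Finset.Ioc M (2 * M)).filter (fun m => m ≡ a [MOD j]), f m)
              - (∑ m ∈ Finset.Ioc M (2 * M), f m) / (j : ℝ)) *
            ((∑ m ∈ (Finset.Ioc M (2 * M)).filter (fun m => m ≡ a [MOD j]), g m)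
              - (∑ m ∈ Finset.Ioc M (2 * M), g m) / (j : ℝ)) := by
  intro f g M j hj
  rw [normalForm_coset_eq_classInner f g M j hj]
  have hj' : (j : ℝ) ≠ 0 := by exact_mod_cast (Nat.one_le_iff_ne_zero.mp hj)
  -- abbreviations (local, proof-only): class sums and block sums
  set A : ℕ → ℝ := fun a => ∑ m ∈ (Ioc M (2 * M)).filter (fun m => m ≡ a [MOD j]), f m with hA
  set B : ℕ → ℝ := fun a => ∑ m ∈ (Ioc M (2 * M)).filter (fun m => m ≡ a [MOD j]), g m with hB
  set Sf : ℝ := ∑ m ∈ Ioc M (2 * M), f m with hSf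
  set Sg : ℝ := ∑ m ∈ Ioc M (2 * M), g m with hSg
  have hAsum : ∑ a ∈ range j, A a = Sf := normalForm_sum_classSum f M j hj
  have hBsum : ∑ a ∈ range j, B a = Sg := normalForm_sum_classSum g M j hj
  show ∑ a ∈ range j, A a * B a - Sf * Sg / j
      = ∑ a ∈ range j, (A a - Sf / j) * (B a - Sg / j)
  have e : ∀ a : ℕ, (A a - Sf / j) * (B a - Sg / j)
      = A a * B a - (Sg / j) * A a - (Sf / j) * B a + (Sf / j) * (Sg / j) := by
    intro a; ring
  simp_rw [e]
  rw [sum_add_distrib, sum_sub_distrib, sum_sub_distrib, ← mul_sum, ← mul_sum, hAsum, hBsum,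
    sum_const, card_range, nsmul_eq_mul]
  field_simp
  ring

end Summit.Parity.GeneralizedHardyLittlewood.Theorems.CosetDecorrelation.FareyLevelMeanCoupling
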